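import Summits.BirchSwinnertonDyer.BirchSwinnertonDyer.Theorems.PublishedInputsGreenbergLayerCocycles
import HarnessLib

set_option linter.dupNamespace false -- `…BirchSwinnertonDyer.BirchSwinnertonDyer…` is the cell's nested layout (D-0017)
set_option autoImplicit false

/-!
# Greenberg LNM 1716 Lemma 3.4 at the layers `n ≥ 1`, brick 10: the quotient `Gal(K̄/K_n) ↠ Gal(K_∞/K_n) ≅ ℤ_p` as a
# continuous surjection `κ_n = p^{-n} κ : H_n ↠ ℤ_p` with kernel `Gal(K̄/K_∞)` and `κ_n(γ₀^{pⁿ}) = 1`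

Seat `bsd-inputs-k4-p1` (gen 6; LADDER-BSD D-0154 KEY (147)(f) «prove the printed input», row 1 K4 INPUTS; Greenberg
1999), `--supports stmt-BirchSwinnertonDyer-20309`. THEOREMS ONLY (no definition, no named fact, no `sorry`): the
homomorphism is produced by an existence statement.

Greenberg, LNM 1716 (1999), §3 p. 86 / §4 p. 108: `Γ_{v_n} = Gal((F_∞)_η/(F_n)_{v_n}) ≅ ℤ_p` has `p`-cohomological
dimension `1`. The tree's Hochschild–Serre edge theorem
(`exists_conjMap_sub_eq_of_resSubgroup_two_injective`) and `cd_p ≤ 1` for `ℤ_p`-quotients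
(`groupCdLE_one_quotient_ker_of_surjective`) are phrased for a continuous surjection `G ↠ ℤ_p` of a profinite group; at the
layer `n` of a `ℤ_p`-extension `κ` (`H_n = κ⁻¹(pⁿℤ_p)`) that surjection is `κ_n = p^{-n} κ|_{H_n}`:

* `exists_layer_continuousMonoidHom` — there is a continuous surjective `κ_n : H_n →ₜ* ℤ_p` with
  `κ h = pⁿ κ_n h`, `ker κ_n = (ker κ) ∩ H_n`, and `κ_n(γ₀^{pⁿ}) = 1` for a topological generator `γ₀` of `κ`.

HONEST FRAMING: bookkeeping on `ℤ_p`-extensions (TOOL theorem); closes nothing; no summit statement is proved; BSD is not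
proved by any of this.

References: [Washington1997] §13.1; [GreenbergLNM1716] §3 p. 86, §4 p. 108; [SerreGaloisCohomology1997] I §3.4.
-/

noncomputable section

open scoped Classical

universe u

namespace Summit.BirchSwinnertonDyer.BirchSwinnertonDyer.Theorems.InputsGreenbergLemma34Layer

open Field Literature.NumberTheory.EllipticCurves Literature.NumberTheory.EllipticCurves.ZpExtension Filter Topology

variable {K : Type u} [Field K] {p : ℕ} [hp : Fact p.Prime] (κ : ZpExtension K p)

/-- **`κ_n = p^{-n} κ : H_n = Gal(K̄/K_n) ↠ ℤ_p`**, a continuous surjective homomorphism on the open subgroup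
`H_n = κ⁻¹(pⁿℤ_p)` with `κ h = pⁿ · κ_n h`, kernel `Gal(K̄/K_∞) = ker κ`, and `κ_n(γ₀^{pⁿ}) = 1` for a topological
generator `γ₀` (so `γ₀^{pⁿ}` is a topological generator of `Gal(K_∞/K_n) ≅ ℤ_p`). Continuity: `κ_n⁻¹(p^m ℤ_p) ⊇
κ⁻¹(p^{n+m}ℤ_p) ∩ H_n`, an open subgroup. [cite: Washington1997, §13.1] [cite: GreenbergLNM1716, §3 p. 86] -/
theorem exists_layer_continuousMonoidHom {γ₀ : absoluteGaloisGroup K} (hγ₀ : κ.IsTopGenerator γ₀) (n : ℕ) :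
    ∃ φ : κ.layerSubgroup n →ₜ* Multiplicative ℤ_[p], Function.Surjective φ ∧
      (∀ h : κ.layerSubgroup n, (κ (h : absoluteGaloisGroup K)).toAdd = (p : ℤ_[p]) ^ n * (φ h).toAdd) ∧
      (∀ h : κ.layerSubgroup n, (h : absoluteGaloisGroup K) ∈ κ.kerSubgroup ↔ φ h = 1) ∧
      φ ⟨γ₀ ^ p ^ n, pow_mem_layerSubgroup κ hγ₀ n⟩ = Multiplicative.ofAdd 1 := by
  let G := absoluteGaloisGroup K
  let Hn : Subgroup G := κ.layerSubgroup n
  have hp0 : (p : ℤ_[p]) ≠ 0 := by exact_mod_cast hp.out.ne_zero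
  have hpn : ((p : ℤ_[p]) ^ n) ≠ 0 := pow_ne_zero n hp0
  -- the quotient `z h = κ h / pⁿ`
  have hex : ∀ h : Hn, ∃ z : ℤ_[p], (κ (h : G)).toAdd = (p : ℤ_[p]) ^ n * z := fun h ↦
    ZpExtension.mem_layerSubgroup.mp h.2
  choose z hz using hex
  have hzmul : ∀ a b : Hn, z (a * b) = z a + z b := fun a b ↦ by
    apply mul_left_cancel₀ hpn
    rw [← hz, mul_add, ← hz, ← hz, Subgroup.coe_mul, map_mul, toAdd_mul]
  have hz1 : z 1 = 0 := by
    have h := hzmul 1 1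
    rw [mul_one, left_eq_add] at h
    exact h
  have hzinv : ∀ a b : Hn, z (a⁻¹ * b) = z b - z a := fun a b ↦ by
    have h := hzmul a (a⁻¹ * b)
    rw [mul_inv_cancel_left] at h
    rw [h]; ring
  -- the homomorphism
  let φ₀ : Hn →* Multiplicative ℤ_[p] :=
    { toFun := fun h ↦ Multiplicative.ofAdd (z h)
      map_one' := by rw [hz1]; rfl
      map_mul' := fun a b ↦ by rw [hzmul]; rfl }
  have hφ₀ : ∀ h : Hn, (φ₀ h).toAdd = z h := fun _ ↦ rfl
  -- continuity of `z`
  have hzcont : Continuous z := by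
    refine continuous_iff_continuousAt.mpr fun x ↦ Metric.tendsto_nhds.mpr fun ε hε ↦ ?_
    obtain ⟨m, hm⟩ := exists_pow_lt_of_lt_one hε (show ((p : ℝ)⁻¹) < 1 from
      inv_lt_one_of_one_lt₀ (by exact_mod_cast hp.out.one_lt))
    have hopen : IsOpen {y : Hn | (x : G)⁻¹ * (y : G) ∈ κ.layerSubgroup (n + m)} :=
      (κ.isOpen_layerSubgroup (n + m)).preimage (continuous_const.mul continuous_subtype_val)
    have hxmem : x ∈ {y : Hn | (x : G)⁻¹ * (y : G) ∈ κ.layerSubgroup (n + m)} := by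
      change (x : G)⁻¹ * (x : G) ∈ κ.layerSubgroup (n + m)
      rw [inv_mul_cancel]; exact one_mem _
    refine Filter.eventually_of_mem (hopen.mem_nhds hxmem) fun y hy ↦ ?_
    have hy' : (p : ℤ_[p]) ^ (n + m) ∣ (κ ((x : G)⁻¹ * (y : G))).toAdd := ZpExtension.mem_layerSubgroup.mp hy
    have hdiff : (κ ((x : G)⁻¹ * (y : G))).toAdd = (p : ℤ_[p]) ^ n * (z y - z x) := by
      rw [← hzinv]
      exact hz (x⁻¹ * y)
    rw [hdiff, pow_add] at hy'
    have hdvd : (p : ℤ_[p]) ^ m ∣ z y - z x := (mul_dvd_mul_iff_left hpn).mp hy'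
    rw [dist_eq_norm]
    refine lt_of_le_of_lt ((PadicInt.norm_le_pow_iff_mem_span_pow _ m).mpr (Ideal.mem_span_singleton.mpr hdvd)) ?_
    rw [zpow_neg, zpow_natCast, ← inv_pow]
    exact hm
  let φ : Hn →ₜ* Multiplicative ℤ_[p] := ⟨φ₀, continuous_ofAdd.comp hzcont⟩
  have hφ : ∀ h : Hn, (φ h).toAdd = z h := fun _ ↦ rfl
  refine ⟨φ, fun t ↦ ?_, fun h ↦ by rw [hφ]; exact hz h, fun h ↦ ?_, ?_⟩
  · -- surjectivity: `κ g₀ = pⁿ t` has `g₀ ∈ H_n` and `φ g₀ = t`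
    obtain ⟨g₀, hg₀⟩ := κ.surjective (Multiplicative.ofAdd ((p : ℤ_[p]) ^ n * t.toAdd))
    have hg₀e : κ g₀ = Multiplicative.ofAdd ((p : ℤ_[p]) ^ n * t.toAdd) := hg₀
    have hg₀' : (κ g₀).toAdd = (p : ℤ_[p]) ^ n * t.toAdd := by rw [hg₀e]; rfl
    have hmem : g₀ ∈ Hn := ZpExtension.mem_layerSubgroup.mpr ⟨t.toAdd, hg₀'⟩
    refine ⟨⟨g₀, hmem⟩, ?_⟩
    apply Multiplicative.toAdd.injective
    rw [hφ]
    apply mul_left_cancel₀ hpn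
    rw [← hz ⟨g₀, hmem⟩]
    exact hg₀'
  · -- kernel
    rw [ZpExtension.mem_kerSubgroup]
    constructor
    · intro h1
      apply Multiplicative.toAdd.injective
      rw [hφ, toAdd_one]
      apply mul_left_cancel₀ hpn
      rw [← hz h, h1, toAdd_one, mul_zero]
    · intro h1
      apply Multiplicative.toAdd.injective
      rw [hz h, toAdd_one, ← hφ, h1, toAdd_one, mul_zero]
  · -- the generator
    apply Multiplicative.toAdd.injective
    rw [hφ, toAdd_ofAdd]
    apply mul_left_cancel₀ hpn
    rw [← hz ⟨γ₀ ^ p ^ n, _⟩, mul_one]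
    have h := κ.toAdd_map_pow_pow hγ₀ n 1
    rw [pow_one, Nat.cast_one, one_mul] at h
    exact h

end Summit.BirchSwinnertonDyer.BirchSwinnertonDyer.Theorems.InputsGreenbergLemma34Layer

end
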